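import Summits.RiemannHypothesis.RiemannHypothesis.Theorems.JensenPolynomialsFarGumbelConnector
import Summits.RiemannHypothesis.RiemannHypothesis.Theorems.JensenPolynomialsFarGumbelXi0Box

/-!
# Route `JensenPolynomials`, FAR crux `XiWindowZeroFreeRelFar` (B1-rel far) — S3 WANTED item (L4) `wanted_connector`
(RH-FREE; cell rh-jensen, HUMAN RULING D-0040)

Item `stmt-RiemannHypothesis-19465`, stub S3 `stub_laplaceFar`, eng-4 g3's WANTED list v3 (HOME `eng-4/S3/S3-WANTED.lean`,
sha16 d6f8107cd04d985a), item (L4), name and signature verbatim: for every `u_s` of the saddle disc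
`‖u_s − (υ + ξ₀/4)‖ ≤ 1/(10υ²)` and `t ∈ [[0, Im u_s]]`, the connector integrand at `υ − 2 + it` is at most `exp(Re Ψ(u_s) − Λ)`.
Proof: the saddle disc lies in the box `|Re u_s − υ| ≤ 3/20`, `|Im u_s| ≤ 1/10` by (L0) `wanted_xi0_box` (eng-2 g3:
`|Re ξ₀| ≤ 1/2`, `|Im ξ₀| ≤ 39/100`) and `1/(10υ²) ≤ 1/890`; then `connector_pointwise_le`
(`JensenPolynomialsFarGumbelConnector.lean`, prover g5). WHAT THIS IS NOT: nothing here bears on the zeros of `ζ` or RH.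
-/

noncomputable section
-- D-0017: `Summit.RiemannHypothesis.RiemannHypothesis.…` duplicates the namespace BY DESIGN (single-problem summit).
set_option linter.dupNamespace false

namespace Summit.RiemannHypothesis.RiemannHypothesis.Theorems.JensenPolynomials.FarGumbel

open Literature.NumberTheory.LFunctions MeasureTheory Set Complex
open scoped Real

/-- **(L4) of the S3 WANTED list v3: the vertical connector** at `Re u = υ − 2` is `e^{−Λ}` below the saddle value. -/
theorem wanted_connector (M : ℕ) (hM : 2 * 10 ^ 18 ≤ M) (υ : ℝ)
    (hυ : (189 / 20 : ℝ) ≤ υ ∧ 4 * Real.pi * Real.exp (4 * υ) * υ = 2 * (M : ℝ) + 9 * υ)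
    (a : ℂ) (ha : ‖a‖ ≤ (9 / 25 : ℝ) * υ ^ 2) (u_s : ℂ)
    (hu : ‖u_s - ((υ : ℂ) + farXi0 (farW (a / (υ : ℂ) ^ 2)) (1 / υ) / 4)‖ ≤ 1 / (10 * υ ^ 2))
    (t : ℝ) (ht : t ∈ Set.uIcc (0 : ℝ) u_s.im) :
    ‖deBruijnPhiC ((υ - 2 : ℝ) + t * I) *
        ((((υ - 2 : ℝ) : ℂ) + t * I) * ((((υ - 2 : ℝ) : ℂ) + t * I) ^ 2 + a) ^ ((M : ℂ) - 1 / 2))‖ ≤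
      Real.exp ((farPsi M a u_s).re - farLam υ) := by
  have _hM := hM
  obtain ⟨hυ0, hmode⟩ := hυ
  have hυpos : 0 < υ := by linarith
  have hυ2 : (89 : ℝ) ≤ υ ^ 2 := by nlinarith
  -- the geometry of `ξ₀` from (L0)
  set z := a / (υ : ℂ) ^ 2 with hzdef
  have hnυ2 : ‖(υ : ℂ) ^ 2‖ = υ ^ 2 := by
    rw [norm_pow, Complex.norm_real, Real.norm_eq_abs, abs_of_pos hυpos]
  have hz : ‖z‖ ≤ 9 / 25 := by
    rw [hzdef, norm_div, hnυ2, div_le_iff₀ (by positivity)]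
    exact ha
  have hε : (1 / υ : ℝ) ≤ 20 / 189 := by
    rw [div_le_div_iff₀ hυpos (by norm_num)]; linarith
  obtain ⟨him, hre⟩ := wanted_xi0_box z hz (1 / υ) (by positivity) hε
  set ξ₀ := farXi0 (farW z) (1 / υ) with hξ0
  set d : ℂ := u_s - ((υ : ℂ) + ξ₀ / 4) with hddef
  have hd : ‖d‖ ≤ 1 / 890 := by
    have : 1 / (10 * υ ^ 2) ≤ (1 : ℝ) / 890 := one_div_le_one_div_of_le (by norm_num) (by linarith only [hυ2])
    exact hu.trans this
  have hdre : |d.re| ≤ 1 / 890 := (Complex.abs_re_le_norm d).trans hd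
  have hdim : |d.im| ≤ 1 / 890 := (Complex.abs_im_le_norm d).trans hd
  -- the box
  have hus : u_s = d + ((υ : ℂ) + ξ₀ / 4) := by rw [hddef]; ring
  have h4re : (ξ₀ / 4).re = ξ₀.re / 4 := by simp
  have h4im : (ξ₀ / 4).im = ξ₀.im / 4 := by simp
  have hre_eq : u_s.re - υ = d.re + ξ₀.re / 4 := by
    rw [hus, Complex.add_re, Complex.add_re, Complex.ofReal_re, h4re]; ring
  have him_eq : u_s.im = d.im + ξ₀.im / 4 := by
    rw [hus, Complex.add_im, Complex.add_im, Complex.ofReal_im, h4im]; ring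
  have hxs : |u_s.re - υ| ≤ 3 / 20 := by
    rw [hre_eq, abs_le]
    obtain ⟨h1, h2⟩ := abs_le.mp hdre
    obtain ⟨h3, h4⟩ := abs_le.mp hre
    constructor <;> linarith
  have hys : |u_s.im| ≤ 1 / 10 := by
    rw [him_eq, abs_le]
    obtain ⟨h1, h2⟩ := abs_le.mp hdim
    obtain ⟨h3, h4⟩ := abs_le.mp him
    constructor <;> linarith
  -- `|t| ≤ 1/10`
  have ht' : |t| ≤ 1 / 10 := by
    obtain ⟨hy1, hy2⟩ := abs_le.mp hys
    rcases Set.mem_uIcc.mp ht with ⟨h0, h1⟩ | ⟨h0, h1⟩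
    · rw [abs_of_nonneg h0]; linarith
    · rw [abs_of_nonpos h1]; linarith
  have key := connector_pointwise_le M ⟨hυ0, hmode⟩ ha hxs hys ht'
  rw [Complex.re_add_im] at key
  calc _ ≤ Real.exp (-farLam υ) * Real.exp (farPsi M a u_s).re := key
    _ = Real.exp ((farPsi M a u_s).re - farLam υ) := by rw [← Real.exp_add]; congr 1; ring

end Summit.RiemannHypothesis.RiemannHypothesis.Theorems.JensenPolynomials.FarGumbel

end
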